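import Mathlib.Algebra.BigOperators.Group.Finset.Basic
import Mathlib.Algebra.Order.BigOperators.Group.Finset
import Mathlib.Data.Fintype.BigOperators
import Mathlib.Tactic
import HarnessLib
import Summits.Ventures.HSemireg.FlatTriangleFreeFourCycles

/-!
# Venture HSemireg — kernel leg of THEOREM L′ (W5 seat w5-n6-2 gen 17): the box count for flat four-coordinate designs with triangles
Bookkeeping of the computation cell `pub-hsemireg`, group W5 (note `widen/W5/FLATTF-w5n62g17.md` §8,
scripts `widen/W5/n6code2/v20/flattf/`). Setting as in `FlatTriangleFreeFourCycles.lean` (same seat):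
four level types `A, B, C, D` (here `α β γ δ`) with `t` levels, the six torus graphs given by
neighbourhood maps `nXY` and their transposes, every level of margin `d` in each graph (FLAT). Here
triangles ARE allowed. All counts below are sums over a level `a` of `A` and its neighbours, i.e.
EDGE-SUBSET counts over transversals in the sense of N7-FEASIBILITY §3.8 (a):
* `N₁, N₂, N₃` — transversal 4-cycles of the cyclic orders `(A B C D)`, `(A B D C)`, `(A C B D)`;
* `T_ABC, T_ABD, T_ACD, T_BCD` — transversal triangles on the four triples;
* `F_XY` — transversals carrying the five tori other than `{X, Y}` («F₅», chords allowed);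
* `K₄` — transversals carrying all six tori.
Results:
* `sum_inter_comm` — filtered double counting (`sum_card_inter_comm` is reused from `FlatTriangleFreeFourCycles`);
* `box_bound_overlap` — the box count for ONE torus with overlapping halves: for `d`-sets
  `S₁, S₂ ⊆ Y`, `K₁, K₂ ⊆ W` in a `d`-biregular `Y – W` graph on `t + t` levels,
  `4d² + e(S₁,K₁∩K₂) + e(S₂,K₁∩K₂) + e(S₁∩S₂,K₁) + e(S₁∩S₂,K₂)
     ≤ e(S₂,K₁) + e(S₁,K₂) + e(S₁,K₁) + e(S₂,K₂) + e(S₁∩S₂,K₁∩K₂) + d·#(S₁∩S₂) + d·#(K₁∩K₂) + d·t`;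
* `flat_box_inequality` — **THEOREM L′** (inequality form of the identity of FLATTF §8):
  `12 t d³ + 2 ΣF₅ ≤ 2 ΣN(C₄) + 3 t² d² + 3 d T_tot + 3 N(K₄)`;
* `K4_le`, and `flat_ksecant_levels_le` — **COROLLARY L′**: if moreover the four triangle counts are
  equal to `T₀`, and the `|S| = 4` class equation of N7F §3.8 (a) holds in the integer form
  `t d ΣN = t d (16 t d³ − 2 t² d² − 12 d T₀ + ΣF₅ − K₄) − (3 t d² − T₀)²` (i.e. with
  `s = T₀/(t d) − 3d`, `ΣPaw = 3 d T_tot`, `2ΣB = 12 t d³`, `ΣC = 4 t d³`), then `8 t ≤ 17 d`.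
HONEST FRAMING: finite combinatorics and integer arithmetic only. The identification of the hypotheses
with the cell's flat K-secant coordinate skeleta and of the integer class equation with
`c₄ = m(s² − m)` lives in the notes (N7-FEASIBILITY §3.8–3.9, FLATTF-w5n62g17 §8), not here. Nothing
in this file says that HC, HC_CM or HC_AV holds; no door ∕ tier ∕ report sentence of the cell is a
consequence of this file alone.
-/

namespace Summit.Ventures.HSemireg

namespace FlatFourCoordinateBoxes
open Finset
open FlatTriangleFreeFourCycles (sum_card_inter_comm)

section DoubleCounting
variable {X Y : Type*} [DecidableEq X] [DecidableEq Y]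

/-- Filtered double counting: summing `f` over the adjacent pairs of `S × T` from either side. -/
theorem sum_inter_comm (S : Finset X) (T : Finset Y) (adj : X → Finset Y) (adj' : Y → Finset X) (h : ∀ x y, y ∈ adj x ↔ x ∈ adj' y) (f : X → Y → ℕ) :
    ∑ x ∈ S, ∑ y ∈ T ∩ adj x, f x y = ∑ y ∈ T, ∑ x ∈ S ∩ adj' y, f x y := by
  have h1 : ∀ x, ∑ y ∈ T ∩ adj x, f x y = ∑ y ∈ T, if x ∈ adj' y then f x y else 0 := by
    intro x; rw [← Finset.filter_mem_eq_inter, Finset.filter_congr (fun y _ => h x y), Finset.sum_filter]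
  have h2 : ∀ y, ∑ x ∈ S ∩ adj' y, f x y = ∑ x ∈ S, if x ∈ adj' y then f x y else 0 := by
    intro y; rw [← Finset.filter_mem_eq_inter, Finset.sum_filter]
  simp_rw [h1, h2]; exact Finset.sum_comm

end DoubleCounting

section Box
variable {Y W : Type*} [Fintype W] [DecidableEq Y] [DecidableEq W]

/-- **Box count with overlapping halves** (LEMMA 1′ + LEMMA 2 of FLATTF §8, for one torus). `S₁, S₂ ⊆ Y`
and `K₁, K₂ ⊆ W` are `d`-sets (the two halves of each side of the box may overlap: the overlaps are
the apexes of the triangles on the torus); the graph `Y – W` is `d`-biregular on `t + t` levels. Then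
the inclusion–exclusion expansion of `e(S₁ ∪ S₂, K₁ ∪ K₂) ≥ d·#(S₁ ∪ S₂) + d·#(K₁ ∪ K₂) − d t` reads,
additively, `4d² + e(S₁,K₁∩K₂) + e(S₂,K₁∩K₂) + e(S₁∩S₂,K₁) + e(S₁∩S₂,K₂) ≤ e(S₂,K₁) + e(S₁,K₂) +
e(S₁,K₁) + e(S₂,K₂) + e(S₁∩S₂,K₁∩K₂) + d #(S₁∩S₂) + d #(K₁∩K₂) + d t`. -/
theorem box_bound_overlap (d t : ℕ) (hW : Fintype.card W = t) (nYW : Y → Finset W) (nWY : W → Finset Y) (hc : ∀ y w, w ∈ nYW y ↔ y ∈ nWY w) (hY : ∀ y, (nYW y).card = d) (hWd : ∀ w, (nWY w).card = d)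
    (S₁ S₂ : Finset Y) (K₁ K₂ : Finset W) (hS₁ : S₁.card = d) (hS₂ : S₂.card = d) (hK₁ : K₁.card = d) (hK₂ : K₂.card = d) :
    4 * d ^ 2 + (∑ y ∈ S₁, (nYW y ∩ (K₁ ∩ K₂)).card) + (∑ y ∈ S₂, (nYW y ∩ (K₁ ∩ K₂)).card) + (∑ y ∈ S₁ ∩ S₂, (nYW y ∩ K₁).card) + (∑ y ∈ S₁ ∩ S₂, (nYW y ∩ K₂).card) ≤ (∑ y ∈ S₂, (nYW y ∩ K₁).card) + (∑ y ∈ S₁, (nYW y ∩ K₂).card) + (∑ y ∈ S₁, (nYW y ∩ K₁).card) + (∑ y ∈ S₂, (nYW y ∩ K₂).card)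
        + (∑ y ∈ S₁ ∩ S₂, (nYW y ∩ (K₁ ∩ K₂)).card) + d * (S₁ ∩ S₂).card + d * (K₁ ∩ K₂).card + d * t := by
  classical
  set K : Finset W := K₁ ∪ K₂ with hK
  set R : Finset W := univ \ K with hR
  -- per-row bookkeeping: the `d` neighbours of `y` split along `K₁, K₂, R`, with the overlap counted twice
  have row : ∀ y, (nYW y ∩ K₁).card + (nYW y ∩ K₂).card + (nYW y ∩ R).card = d + (nYW y ∩ (K₁ ∩ K₂)).card := by
    intro y
    have h1 : (nYW y ∩ K).card + (nYW y ∩ R).card = d := by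
      have e1 : nYW y ∩ R = nYW y \ K := by ext w; simp only [hR, mem_inter, mem_sdiff, mem_univ, true_and]
      rw [e1, Finset.card_inter_add_card_sdiff, hY y]
    have h2 : (nYW y ∩ K₁).card + (nYW y ∩ K₂).card = (nYW y ∩ K).card + (nYW y ∩ (K₁ ∩ K₂)).card := by
      have e2 : nYW y ∩ K = (nYW y ∩ K₁) ∪ (nYW y ∩ K₂) := by rw [hK]; exact Finset.inter_union_distrib_left _ _ _
      have e3 : nYW y ∩ (K₁ ∩ K₂) = (nYW y ∩ K₁) ∩ (nYW y ∩ K₂) := by ext w; simp only [mem_inter]; tauto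
      rw [e2, e3, Finset.card_union_add_card_inter]
    omega
  -- sums of the row identity over S₁, S₂ and S₁ ∩ S₂
  have sum₁ : (∑ y ∈ S₁, (nYW y ∩ K₁).card) + (∑ y ∈ S₁, (nYW y ∩ K₂).card) + (∑ y ∈ S₁, (nYW y ∩ R).card) = d * d + ∑ y ∈ S₁, (nYW y ∩ (K₁ ∩ K₂)).card := by
    rw [← Finset.sum_add_distrib, ← Finset.sum_add_distrib, Finset.sum_congr rfl (fun y _ => row y),
      Finset.sum_add_distrib, Finset.sum_const, hS₁, smul_eq_mul]
  have sum₂ : (∑ y ∈ S₂, (nYW y ∩ K₁).card) + (∑ y ∈ S₂, (nYW y ∩ K₂).card) + (∑ y ∈ S₂, (nYW y ∩ R).card) = d * d + ∑ y ∈ S₂, (nYW y ∩ (K₁ ∩ K₂)).card := by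
    rw [← Finset.sum_add_distrib, ← Finset.sum_add_distrib, Finset.sum_congr rfl (fun y _ => row y),
      Finset.sum_add_distrib, Finset.sum_const, hS₂, smul_eq_mul]
  have sum₀ : (∑ y ∈ S₁ ∩ S₂, (nYW y ∩ K₁).card) + (∑ y ∈ S₁ ∩ S₂, (nYW y ∩ K₂).card) + (∑ y ∈ S₁ ∩ S₂, (nYW y ∩ R).card) = d * (S₁ ∩ S₂).card + ∑ y ∈ S₁ ∩ S₂, (nYW y ∩ (K₁ ∩ K₂)).card := by
    rw [← Finset.sum_add_distrib, ← Finset.sum_add_distrib, Finset.sum_congr rfl (fun y _ => row y),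
      Finset.sum_add_distrib, Finset.sum_const, smul_eq_mul, mul_comm]
  -- the edges leaving the box through `R`
  have rest : (∑ y ∈ S₁, (nYW y ∩ R).card) + (∑ y ∈ S₂, (nYW y ∩ R).card) ≤ R.card * d + ∑ y ∈ S₁ ∩ S₂, (nYW y ∩ R).card := by
    have hui : (∑ y ∈ S₁ ∪ S₂, (nYW y ∩ R).card) + (∑ y ∈ S₁ ∩ S₂, (nYW y ∩ R).card) = (∑ y ∈ S₁, (nYW y ∩ R).card) + (∑ y ∈ S₂, (nYW y ∩ R).card) := Finset.sum_union_inter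
    have hle : ∑ y ∈ S₁ ∪ S₂, (nYW y ∩ R).card ≤ R.card * d := by
      calc ∑ y ∈ S₁ ∪ S₂, (nYW y ∩ R).card ≤ ∑ y ∈ (S₁ ∪ S₂) ∪ (R.biUnion nWY), (nYW y ∩ R).card :=
            Finset.sum_le_sum_of_subset (Finset.subset_union_left)
        _ = ∑ w ∈ R, (nWY w ∩ ((S₁ ∪ S₂) ∪ (R.biUnion nWY))).card := sum_card_inter_comm _ _ nYW nWY hc
        _ = ∑ w ∈ R, d := by
            refine Finset.sum_congr rfl (fun w hw => ?_)
            have hsub : nWY w ⊆ (S₁ ∪ S₂) ∪ (R.biUnion nWY) := fun y hy => Finset.mem_union_right _ (Finset.mem_biUnion.mpr ⟨w, hw, hy⟩)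
            rw [Finset.inter_eq_left.mpr hsub, hWd w]
        _ = R.card * d := by rw [Finset.sum_const, smul_eq_mul]
    omega
  -- cardinalities: #R + #K = t, #K + #(K₁ ∩ K₂) = 2d
  have hKU : K.card + (K₁ ∩ K₂).card = 2 * d := by rw [hK, Finset.card_union_add_card_inter, hK₁, hK₂]; ring
  have hRcard : R.card + K.card = t := by
    have h1 : R.card = (univ : Finset W).card - K.card := by rw [hR, Finset.card_sdiff, Finset.inter_univ]
    have h2 : K.card ≤ (univ : Finset W).card := Finset.card_le_univ _
    rw [Finset.card_univ, hW] at h1 h2; omega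
  obtain ⟨r, hr⟩ : ∃ r, R.card = r := ⟨_, rfl⟩
  obtain ⟨k, hk⟩ : ∃ k, K.card = k := ⟨_, rfl⟩
  obtain ⟨i, hi⟩ : ∃ i, (K₁ ∩ K₂).card = i := ⟨_, rfl⟩
  rw [hr] at rest hRcard; rw [hk] at hKU hRcard; rw [hi] at hKU ⊢
  have ht : t = r + k := by omega
  subst ht
  have hk' : k = 2 * d - i := by omega
  have hid : i ≤ 2 * d := by omega
  nlinarith [sum₁, sum₂, sum₀, rest, hKU]

end Box

section Design
variable {α β γ δ : Type*} [Fintype α] [Fintype β] [Fintype γ] [Fintype δ]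
  [DecidableEq α] [DecidableEq β] [DecidableEq γ] [DecidableEq δ]

/-- Sums over the tori of one pair can be taken from either end. -/
theorem edge_sum_comm (nAB : α → Finset β) (nBA : β → Finset α) (cAB : ∀ a b, b ∈ nAB a ↔ a ∈ nBA b) (g : α → β → ℕ) : ∑ a, ∑ b ∈ nAB a, g a b = ∑ b, ∑ a ∈ nBA b, g a b := by
  have := sum_inter_comm (univ : Finset α) (univ : Finset β) nAB nBA cAB g
  simpa [Finset.univ_inter] using this

/-- **THEOREM L′** (FLATTF-w5n62g17 §8, inequality form). For a FLAT four-coordinate design (margin `d`,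
`t` levels, triangles allowed): `12 t d³ + 2 ΣF₅ ≤ 2 ΣN(C₄) + 3 t² d² + 3 d T_tot + 3 N(K₄)`, every count
written as an explicit sum from a level `a ∈ A` (see the module docstring for the dictionary). -/
theorem flat_box_inequality (d t : ℕ)
    (hα : Fintype.card α = t) (hγ : Fintype.card γ = t) (hδ : Fintype.card δ = t) (nAB : α → Finset β) (nBA : β → Finset α) (nAC : α → Finset γ) (nCA : γ → Finset α) (nAD : α → Finset δ) (nDA : δ → Finset α) (nBC : β → Finset γ) (nCB : γ → Finset β)
    (nBD : β → Finset δ) (nDB : δ → Finset β) (nCD : γ → Finset δ) (nDC : δ → Finset γ) (cAB : ∀ a b, b ∈ nAB a ↔ a ∈ nBA b) (cAC : ∀ a c, c ∈ nAC a ↔ a ∈ nCA c)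
    (cAD : ∀ a e, e ∈ nAD a ↔ a ∈ nDA e) (cBC : ∀ b c, c ∈ nBC b ↔ b ∈ nCB c)
    (cBD : ∀ b e, e ∈ nBD b ↔ b ∈ nDB e) (cCD : ∀ c e, e ∈ nCD c ↔ c ∈ nDC e) (rAB : ∀ a, (nAB a).card = d) (rBA : ∀ b, (nBA b).card = d) (rAC : ∀ a, (nAC a).card = d) (rCA : ∀ c, (nCA c).card = d) (rAD : ∀ a, (nAD a).card = d) (rDA : ∀ e, (nDA e).card = d)
    (rBC : ∀ b, (nBC b).card = d) (rCB : ∀ c, (nCB c).card = d) (rBD : ∀ b, (nBD b).card = d) (rDB : ∀ e, (nDB e).card = d) (rCD : ∀ c, (nCD c).card = d) (rDC : ∀ e, (nDC e).card = d) :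
    12 * t * d ^ 3 + 2 * ((∑ a, ∑ c ∈ nAC a, ∑ e ∈ nAD a ∩ nCD c, (nCB c ∩ nDB e).card) + (∑ a, ∑ b ∈ nAB a, ∑ e ∈ nAD a ∩ nBD b, (nBC b ∩ nDC e).card) + (∑ a, ∑ b ∈ nAB a, ∑ c ∈ nAC a ∩ nBC b, (nBD b ∩ nCD c).card) + (∑ a, ∑ b ∈ nAB a, ∑ c ∈ nAC a, (nAD a ∩ nBD b ∩ nCD c).card)
           + (∑ a, ∑ b ∈ nAB a, ∑ c ∈ nAC a ∩ nBC b, (nAD a ∩ nCD c).card) + (∑ a, ∑ b ∈ nAB a, ∑ _c ∈ nAC a ∩ nBC b, (nAD a ∩ nBD b).card)) ≤ 2 * ((∑ a, ∑ b ∈ nAB a, ∑ e ∈ nAD a, (nBC b ∩ nDC e).card) + (∑ a, ∑ b ∈ nAB a, ∑ c ∈ nAC a, (nBD b ∩ nCD c).card) + (∑ a, ∑ c ∈ nAC a, ∑ e ∈ nAD a, (nCB c ∩ nDB e).card))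
      + 3 * t ^ 2 * d ^ 2 + 3 * d * ((∑ a, ∑ b ∈ nAB a, (nAC a ∩ nBC b).card) + (∑ a, ∑ b ∈ nAB a, (nAD a ∩ nBD b).card) + (∑ a, ∑ c ∈ nAC a, (nAD a ∩ nCD c).card) + (∑ b, ∑ c ∈ nBC b, (nBD b ∩ nCD c).card)) + 3 * (∑ a, ∑ b ∈ nAB a, ∑ c ∈ nAC a ∩ nBC b, (nAD a ∩ nBD b ∩ nCD c).card)
      := by
  classical
  -- matching {AB, CD}: boxes in C × D over the AB-tori (S₁ = nAC a, S₂ = nBC b; K₁ = nAD a, K₂ = nBD b)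
  have key₁ : ∀ a, ∀ b ∈ nAB a,
      4 * d ^ 2 + (∑ c ∈ nAC a, (nAD a ∩ nBD b ∩ nCD c).card) + (∑ e ∈ nAD a ∩ nBD b, (nBC b ∩ nDC e).card) + (∑ c ∈ nAC a ∩ nBC b, (nAD a ∩ nCD c).card) + (∑ c ∈ nAC a ∩ nBC b, (nBD b ∩ nCD c).card) ≤ (∑ e ∈ nAD a, (nBC b ∩ nDC e).card) + (∑ c ∈ nAC a, (nBD b ∩ nCD c).card)
        + (∑ c ∈ nAC a, (nAD a ∩ nCD c).card) + (∑ c ∈ nBC b, (nBD b ∩ nCD c).card) + (∑ c ∈ nAC a ∩ nBC b, (nAD a ∩ nBD b ∩ nCD c).card) + d * (nAC a ∩ nBC b).card + d * (nAD a ∩ nBD b).card + d * t := by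
    intro a b hb
    have hbox := box_bound_overlap d t hδ nCD nDC cCD rCD rDC (nAC a) (nBC b) (nAD a) (nBD b) (rAC a) (rBC b) (rAD a) (rBD b)
    have e1 : ∑ c ∈ nBC b, (nCD c ∩ nAD a).card = ∑ e ∈ nAD a, (nBC b ∩ nDC e).card := by
      rw [sum_card_inter_comm (nBC b) (nAD a) nCD nDC cCD]; exact Finset.sum_congr rfl (fun e _ => by rw [Finset.inter_comm])
    have e2 : ∑ c ∈ nAC a, (nCD c ∩ nBD b).card = ∑ c ∈ nAC a, (nBD b ∩ nCD c).card := Finset.sum_congr rfl (fun c _ => by rw [Finset.inter_comm])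
    have e3 : ∑ c ∈ nAC a, (nCD c ∩ nAD a).card = ∑ c ∈ nAC a, (nAD a ∩ nCD c).card := Finset.sum_congr rfl (fun c _ => by rw [Finset.inter_comm])
    have e4 : ∑ c ∈ nBC b, (nCD c ∩ nBD b).card = ∑ c ∈ nBC b, (nBD b ∩ nCD c).card := Finset.sum_congr rfl (fun c _ => by rw [Finset.inter_comm])
    have e5 : ∑ c ∈ nAC a, (nCD c ∩ (nAD a ∩ nBD b)).card = ∑ c ∈ nAC a, (nAD a ∩ nBD b ∩ nCD c).card := Finset.sum_congr rfl (fun c _ => by rw [Finset.inter_comm])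
    have e6 : ∑ c ∈ nBC b, (nCD c ∩ (nAD a ∩ nBD b)).card = ∑ e ∈ nAD a ∩ nBD b, (nBC b ∩ nDC e).card := by
      rw [sum_card_inter_comm (nBC b) (nAD a ∩ nBD b) nCD nDC cCD]; exact Finset.sum_congr rfl (fun e _ => by rw [Finset.inter_comm])
    have e7 : ∑ c ∈ nAC a ∩ nBC b, (nCD c ∩ nAD a).card = ∑ c ∈ nAC a ∩ nBC b, (nAD a ∩ nCD c).card := Finset.sum_congr rfl (fun c _ => by rw [Finset.inter_comm])
    have e8 : ∑ c ∈ nAC a ∩ nBC b, (nCD c ∩ nBD b).card = ∑ c ∈ nAC a ∩ nBC b, (nBD b ∩ nCD c).card := Finset.sum_congr rfl (fun c _ => by rw [Finset.inter_comm])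
    have e9 : ∑ c ∈ nAC a ∩ nBC b, (nCD c ∩ (nAD a ∩ nBD b)).card = ∑ c ∈ nAC a ∩ nBC b, (nAD a ∩ nBD b ∩ nCD c).card := Finset.sum_congr rfl (fun c _ => by rw [Finset.inter_comm])
    rw [e1, e2, e3, e4, e5, e6, e7, e8, e9] at hbox; linarith
  have m₁ : t * d * (4 * d ^ 2) + (∑ a, ∑ b ∈ nAB a, ∑ c ∈ nAC a, (nAD a ∩ nBD b ∩ nCD c).card) + (∑ a, ∑ b ∈ nAB a, ∑ e ∈ nAD a ∩ nBD b, (nBC b ∩ nDC e).card) + (∑ a, ∑ b ∈ nAB a, ∑ c ∈ nAC a ∩ nBC b, (nAD a ∩ nCD c).card) + (∑ a, ∑ b ∈ nAB a, ∑ c ∈ nAC a ∩ nBC b, (nBD b ∩ nCD c).card)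
      ≤ (∑ a, ∑ b ∈ nAB a, ∑ e ∈ nAD a, (nBC b ∩ nDC e).card) + (∑ a, ∑ b ∈ nAB a, ∑ c ∈ nAC a, (nBD b ∩ nCD c).card) + d * (∑ a, ∑ c ∈ nAC a, (nAD a ∩ nCD c).card) + d * (∑ b, ∑ c ∈ nBC b, (nBD b ∩ nCD c).card) + (∑ a, ∑ b ∈ nAB a, ∑ c ∈ nAC a ∩ nBC b, (nAD a ∩ nBD b ∩ nCD c).card)
        + d * (∑ a, ∑ b ∈ nAB a, (nAC a ∩ nBC b).card) + d * (∑ a, ∑ b ∈ nAB a, (nAD a ∩ nBD b).card) + t * d * (d * t) := by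
    have hsum := Finset.sum_le_sum (s := (univ : Finset α)) (fun a _ => Finset.sum_le_sum (fun b hb => key₁ a b hb))
    have lhs : ∑ a ∈ (univ : Finset α), ∑ b ∈ nAB a,
        (4 * d ^ 2 + (∑ c ∈ nAC a, (nAD a ∩ nBD b ∩ nCD c).card) + (∑ e ∈ nAD a ∩ nBD b, (nBC b ∩ nDC e).card) + (∑ c ∈ nAC a ∩ nBC b, (nAD a ∩ nCD c).card) + (∑ c ∈ nAC a ∩ nBC b, (nBD b ∩ nCD c).card)) = t * d * (4 * d ^ 2) + (∑ a, ∑ b ∈ nAB a, ∑ c ∈ nAC a, (nAD a ∩ nBD b ∩ nCD c).card)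
          + (∑ a, ∑ b ∈ nAB a, ∑ e ∈ nAD a ∩ nBD b, (nBC b ∩ nDC e).card) + (∑ a, ∑ b ∈ nAB a, ∑ c ∈ nAC a ∩ nBC b, (nAD a ∩ nCD c).card) + (∑ a, ∑ b ∈ nAB a, ∑ c ∈ nAC a ∩ nBC b, (nBD b ∩ nCD c).card) := by
      simp only [Finset.sum_add_distrib, Finset.sum_const, smul_eq_mul, rAB, Finset.card_univ, hα]
      ring
    have diag₁ : ∑ a ∈ (univ : Finset α), ∑ b ∈ nAB a, ∑ c ∈ nAC a, (nAD a ∩ nCD c).card = d * ∑ a, ∑ c ∈ nAC a, (nAD a ∩ nCD c).card := by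
      rw [Finset.mul_sum]; exact Finset.sum_congr rfl (fun a _ => by rw [Finset.sum_const, smul_eq_mul, rAB])
    have diag₂ : ∑ a ∈ (univ : Finset α), ∑ b ∈ nAB a, ∑ c ∈ nBC b, (nBD b ∩ nCD c).card = d * ∑ b, ∑ c ∈ nBC b, (nBD b ∩ nCD c).card := by
      rw [edge_sum_comm nAB nBA cAB, Finset.mul_sum]; exact Finset.sum_congr rfl (fun b _ => by rw [Finset.sum_const, smul_eq_mul, rBA])
    have rhs : ∑ a ∈ (univ : Finset α), ∑ b ∈ nAB a,
        ((∑ e ∈ nAD a, (nBC b ∩ nDC e).card) + (∑ c ∈ nAC a, (nBD b ∩ nCD c).card) + (∑ c ∈ nAC a, (nAD a ∩ nCD c).card) + (∑ c ∈ nBC b, (nBD b ∩ nCD c).card) + (∑ c ∈ nAC a ∩ nBC b, (nAD a ∩ nBD b ∩ nCD c).card) + d * (nAC a ∩ nBC b).card + d * (nAD a ∩ nBD b).card + d * t)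
        = (∑ a, ∑ b ∈ nAB a, ∑ e ∈ nAD a, (nBC b ∩ nDC e).card) + (∑ a, ∑ b ∈ nAB a, ∑ c ∈ nAC a, (nBD b ∩ nCD c).card) + d * (∑ a, ∑ c ∈ nAC a, (nAD a ∩ nCD c).card) + d * (∑ b, ∑ c ∈ nBC b, (nBD b ∩ nCD c).card) + (∑ a, ∑ b ∈ nAB a, ∑ c ∈ nAC a ∩ nBC b, (nAD a ∩ nBD b ∩ nCD c).card)
          + d * (∑ a, ∑ b ∈ nAB a, (nAC a ∩ nBC b).card) + d * (∑ a, ∑ b ∈ nAB a, (nAD a ∩ nBD b).card) + t * d * (d * t) := by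
      rw [← diag₁, ← diag₂]
      simp only [Finset.sum_add_distrib, Finset.sum_const, smul_eq_mul, rAB, Finset.card_univ, hα,
        Finset.mul_sum]
      ring
    rw [lhs, rhs] at hsum; exact hsum
  -- matching {AC, BD}: boxes in B × D over the AC-tori (S₁ = nAB a, S₂ = nCB c; K₁ = nAD a, K₂ = nCD c)
  have key₂ : ∀ a, ∀ c ∈ nAC a,
      4 * d ^ 2 + (∑ b ∈ nAB a, (nAD a ∩ nBD b ∩ nCD c).card) + (∑ e ∈ nAD a ∩ nCD c, (nCB c ∩ nDB e).card) + (∑ b ∈ nAB a ∩ nCB c, (nAD a ∩ nBD b).card) + (∑ b ∈ nAB a ∩ nCB c, (nBD b ∩ nCD c).card) ≤ (∑ e ∈ nAD a, (nCB c ∩ nDB e).card) + (∑ b ∈ nAB a, (nBD b ∩ nCD c).card)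
        + (∑ b ∈ nAB a, (nAD a ∩ nBD b).card) + (∑ b ∈ nCB c, (nBD b ∩ nCD c).card) + (∑ b ∈ nAB a ∩ nCB c, (nAD a ∩ nBD b ∩ nCD c).card) + d * (nAB a ∩ nCB c).card + d * (nAD a ∩ nCD c).card + d * t := by
    intro a c hc
    have hbox := box_bound_overlap d t hδ nBD nDB cBD rBD rDB (nAB a) (nCB c) (nAD a) (nCD c) (rAB a) (rCB c) (rAD a) (rCD c)
    have e1 : ∑ b ∈ nCB c, (nBD b ∩ nAD a).card = ∑ e ∈ nAD a, (nCB c ∩ nDB e).card := by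
      rw [sum_card_inter_comm (nCB c) (nAD a) nBD nDB cBD]; exact Finset.sum_congr rfl (fun e _ => by rw [Finset.inter_comm])
    have e3 : ∑ b ∈ nAB a, (nBD b ∩ nAD a).card = ∑ b ∈ nAB a, (nAD a ∩ nBD b).card := Finset.sum_congr rfl (fun b _ => by rw [Finset.inter_comm])
    have e5 : ∑ b ∈ nAB a, (nBD b ∩ (nAD a ∩ nCD c)).card = ∑ b ∈ nAB a, (nAD a ∩ nBD b ∩ nCD c).card :=
      Finset.sum_congr rfl (fun b _ => by
        congr 1; ext e; simp only [Finset.mem_inter]; tauto)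
    have e6 : ∑ b ∈ nCB c, (nBD b ∩ (nAD a ∩ nCD c)).card = ∑ e ∈ nAD a ∩ nCD c, (nCB c ∩ nDB e).card := by
      rw [sum_card_inter_comm (nCB c) (nAD a ∩ nCD c) nBD nDB cBD]; exact Finset.sum_congr rfl (fun e _ => by rw [Finset.inter_comm])
    have e7 : ∑ b ∈ nAB a ∩ nCB c, (nBD b ∩ nAD a).card = ∑ b ∈ nAB a ∩ nCB c, (nAD a ∩ nBD b).card := Finset.sum_congr rfl (fun b _ => by rw [Finset.inter_comm])
    have e9 : ∑ b ∈ nAB a ∩ nCB c, (nBD b ∩ (nAD a ∩ nCD c)).card = ∑ b ∈ nAB a ∩ nCB c, (nAD a ∩ nBD b ∩ nCD c).card :=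
      Finset.sum_congr rfl (fun b _ => by
        congr 1; ext e; simp only [Finset.mem_inter]; tauto)
    rw [e1, e3, e5, e6, e7, e9] at hbox; linarith
  have m₂ : t * d * (4 * d ^ 2) + (∑ a, ∑ b ∈ nAB a, ∑ c ∈ nAC a, (nAD a ∩ nBD b ∩ nCD c).card) + (∑ a, ∑ c ∈ nAC a, ∑ e ∈ nAD a ∩ nCD c, (nCB c ∩ nDB e).card) + (∑ a, ∑ b ∈ nAB a, ∑ c ∈ nAC a ∩ nBC b, (nAD a ∩ nBD b).card) + (∑ a, ∑ b ∈ nAB a, ∑ c ∈ nAC a ∩ nBC b, (nBD b ∩ nCD c).card)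
      ≤ (∑ a, ∑ c ∈ nAC a, ∑ e ∈ nAD a, (nCB c ∩ nDB e).card) + (∑ a, ∑ b ∈ nAB a, ∑ c ∈ nAC a, (nBD b ∩ nCD c).card) + d * (∑ a, ∑ b ∈ nAB a, (nAD a ∩ nBD b).card) + d * (∑ b, ∑ c ∈ nBC b, (nBD b ∩ nCD c).card) + (∑ a, ∑ b ∈ nAB a, ∑ c ∈ nAC a ∩ nBC b, (nAD a ∩ nBD b ∩ nCD c).card)
        + d * (∑ a, ∑ b ∈ nAB a, (nAC a ∩ nBC b).card) + d * (∑ a, ∑ c ∈ nAC a, (nAD a ∩ nCD c).card) + t * d * (d * t) := by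
    have hsum := Finset.sum_le_sum (s := (univ : Finset α)) (fun a _ => Finset.sum_le_sum (fun c hc => key₂ a c hc))
    have cv1 : ∀ a : α, ∑ c ∈ nAC a, ∑ b ∈ nAB a, (nAD a ∩ nBD b ∩ nCD c).card = ∑ b ∈ nAB a, ∑ c ∈ nAC a, (nAD a ∩ nBD b ∩ nCD c).card := fun a => Finset.sum_comm
    have cv2 : ∀ a : α, ∑ c ∈ nAC a, ∑ b ∈ nAB a ∩ nCB c, (nAD a ∩ nBD b).card = ∑ b ∈ nAB a, ∑ c ∈ nAC a ∩ nBC b, (nAD a ∩ nBD b).card := fun a =>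
      sum_inter_comm (nAC a) (nAB a) nCB nBC (fun c b => (cBC b c).symm) _
    have cv3 : ∀ a : α, ∑ c ∈ nAC a, ∑ b ∈ nAB a ∩ nCB c, (nBD b ∩ nCD c).card = ∑ b ∈ nAB a, ∑ c ∈ nAC a ∩ nBC b, (nBD b ∩ nCD c).card := fun a =>
      sum_inter_comm (nAC a) (nAB a) nCB nBC (fun c b => (cBC b c).symm) _
    have cv4 : ∀ a : α, ∑ c ∈ nAC a, ∑ b ∈ nAB a, (nBD b ∩ nCD c).card = ∑ b ∈ nAB a, ∑ c ∈ nAC a, (nBD b ∩ nCD c).card := fun a => Finset.sum_comm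
    have cv5 : ∀ a : α, ∑ c ∈ nAC a, ∑ b ∈ nAB a ∩ nCB c, (nAD a ∩ nBD b ∩ nCD c).card = ∑ b ∈ nAB a, ∑ c ∈ nAC a ∩ nBC b, (nAD a ∩ nBD b ∩ nCD c).card := fun a =>
      sum_inter_comm (nAC a) (nAB a) nCB nBC (fun c b => (cBC b c).symm) _
    have cv6 : ∀ a : α, ∑ c ∈ nAC a, (nAB a ∩ nCB c).card = ∑ b ∈ nAB a, (nAC a ∩ nBC b).card := by
      intro a
      have h' : ∑ c ∈ nAC a, (nAB a ∩ nCB c).card = ∑ c ∈ nAC a, (nCB c ∩ nAB a).card := Finset.sum_congr rfl (fun c _ => by rw [Finset.inter_comm])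
      rw [h', sum_card_inter_comm (nAC a) (nAB a) nCB nBC (fun c b => (cBC b c).symm)]; exact Finset.sum_congr rfl (fun b _ => by rw [Finset.inter_comm])
    have cv6m : ∀ a : α, ∑ c ∈ nAC a, d * (nAB a ∩ nCB c).card = ∑ b ∈ nAB a, d * (nAC a ∩ nBC b).card := fun a => by
      rw [← Finset.mul_sum, ← Finset.mul_sum, cv6 a]
    have lhs : ∑ a ∈ (univ : Finset α), ∑ c ∈ nAC a,
        (4 * d ^ 2 + (∑ b ∈ nAB a, (nAD a ∩ nBD b ∩ nCD c).card) + (∑ e ∈ nAD a ∩ nCD c, (nCB c ∩ nDB e).card) + (∑ b ∈ nAB a ∩ nCB c, (nAD a ∩ nBD b).card) + (∑ b ∈ nAB a ∩ nCB c, (nBD b ∩ nCD c).card)) = t * d * (4 * d ^ 2) + (∑ a, ∑ b ∈ nAB a, ∑ c ∈ nAC a, (nAD a ∩ nBD b ∩ nCD c).card)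
          + (∑ a, ∑ c ∈ nAC a, ∑ e ∈ nAD a ∩ nCD c, (nCB c ∩ nDB e).card) + (∑ a, ∑ b ∈ nAB a, ∑ c ∈ nAC a ∩ nBC b, (nAD a ∩ nBD b).card) + (∑ a, ∑ b ∈ nAB a, ∑ c ∈ nAC a ∩ nBC b, (nBD b ∩ nCD c).card) := by
      simp only [Finset.sum_add_distrib, Finset.sum_const, smul_eq_mul, rAC, Finset.card_univ, hα,
        cv1, cv2, cv3]
      ring
    have diag₁ : ∑ a ∈ (univ : Finset α), ∑ c ∈ nAC a, ∑ b ∈ nAB a, (nAD a ∩ nBD b).card = d * ∑ a, ∑ b ∈ nAB a, (nAD a ∩ nBD b).card := by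
      rw [Finset.mul_sum]; exact Finset.sum_congr rfl (fun a _ => by rw [Finset.sum_const, smul_eq_mul, rAC])
    have diag₂ : ∑ a ∈ (univ : Finset α), ∑ c ∈ nAC a, ∑ b ∈ nCB c, (nBD b ∩ nCD c).card = d * ∑ b, ∑ c ∈ nBC b, (nBD b ∩ nCD c).card := by
      have step1 : ∑ a ∈ (univ : Finset α), ∑ c ∈ nAC a, ∑ b ∈ nCB c, (nBD b ∩ nCD c).card = d * ∑ c, ∑ b ∈ nCB c, (nBD b ∩ nCD c).card := by
        rw [edge_sum_comm nAC nCA cAC, Finset.mul_sum]; exact Finset.sum_congr rfl (fun c _ => by rw [Finset.sum_const, smul_eq_mul, rCA])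
      have step2 : ∑ c, ∑ b ∈ nCB c, (nBD b ∩ nCD c).card = ∑ b, ∑ c ∈ nBC b, (nBD b ∩ nCD c).card := (edge_sum_comm nBC nCB cBC (fun b c => (nBD b ∩ nCD c).card)).symm
      rw [step1, step2]
    have rhs : ∑ a ∈ (univ : Finset α), ∑ c ∈ nAC a,
        ((∑ e ∈ nAD a, (nCB c ∩ nDB e).card) + (∑ b ∈ nAB a, (nBD b ∩ nCD c).card) + (∑ b ∈ nAB a, (nAD a ∩ nBD b).card) + (∑ b ∈ nCB c, (nBD b ∩ nCD c).card) + (∑ b ∈ nAB a ∩ nCB c, (nAD a ∩ nBD b ∩ nCD c).card) + d * (nAB a ∩ nCB c).card + d * (nAD a ∩ nCD c).card + d * t)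
        = (∑ a, ∑ c ∈ nAC a, ∑ e ∈ nAD a, (nCB c ∩ nDB e).card) + (∑ a, ∑ b ∈ nAB a, ∑ c ∈ nAC a, (nBD b ∩ nCD c).card) + d * (∑ a, ∑ b ∈ nAB a, (nAD a ∩ nBD b).card) + d * (∑ b, ∑ c ∈ nBC b, (nBD b ∩ nCD c).card) + (∑ a, ∑ b ∈ nAB a, ∑ c ∈ nAC a ∩ nBC b, (nAD a ∩ nBD b ∩ nCD c).card)
          + d * (∑ a, ∑ b ∈ nAB a, (nAC a ∩ nBC b).card) + d * (∑ a, ∑ c ∈ nAC a, (nAD a ∩ nCD c).card) + t * d * (d * t) := by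
      rw [← diag₁, ← diag₂]
      simp only [Finset.sum_add_distrib, Finset.sum_const, smul_eq_mul, rAC, Finset.card_univ, hα,
        Finset.mul_sum, cv4, cv5, cv6m]
      ring
    rw [lhs, rhs] at hsum; exact hsum
  -- matching {AD, BC}: boxes in B × C over the AD-tori (S₁ = nAB a, S₂ = nDB e; K₁ = nAC a, K₂ = nDC e)
  have key₃ : ∀ a, ∀ e ∈ nAD a,
      4 * d ^ 2 + (∑ b ∈ nAB a, (nBC b ∩ (nAC a ∩ nDC e)).card) + (∑ c ∈ nAC a ∩ nDC e, (nCB c ∩ nDB e).card) + (∑ b ∈ nAB a ∩ nDB e, (nBC b ∩ nAC a).card) + (∑ b ∈ nAB a ∩ nDB e, (nBC b ∩ nDC e).card) ≤ (∑ c ∈ nAC a, (nCB c ∩ nDB e).card) + (∑ b ∈ nAB a, (nBC b ∩ nDC e).card)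
        + (∑ b ∈ nAB a, (nAC a ∩ nBC b).card) + (∑ b ∈ nDB e, (nBC b ∩ nDC e).card) + (∑ b ∈ nAB a ∩ nDB e, (nBC b ∩ (nAC a ∩ nDC e)).card) + d * (nAB a ∩ nDB e).card + d * (nAC a ∩ nDC e).card + d * t := by
    intro a e he
    have hbox := box_bound_overlap d t hγ nBC nCB cBC rBC rCB (nAB a) (nDB e) (nAC a) (nDC e) (rAB a) (rDB e) (rAC a) (rDC e)
    have e1 : ∑ b ∈ nDB e, (nBC b ∩ nAC a).card = ∑ c ∈ nAC a, (nCB c ∩ nDB e).card := by rw [sum_card_inter_comm (nDB e) (nAC a) nBC nCB cBC]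
    have e3 : ∑ b ∈ nAB a, (nBC b ∩ nAC a).card = ∑ b ∈ nAB a, (nAC a ∩ nBC b).card := Finset.sum_congr rfl (fun b _ => by rw [Finset.inter_comm])
    have e6 : ∑ b ∈ nDB e, (nBC b ∩ (nAC a ∩ nDC e)).card = ∑ c ∈ nAC a ∩ nDC e, (nCB c ∩ nDB e).card := by rw [sum_card_inter_comm (nDB e) (nAC a ∩ nDC e) nBC nCB cBC]
    rw [e1, e3, e6] at hbox; linarith
  have m₃ : t * d * (4 * d ^ 2) + (∑ a, ∑ b ∈ nAB a, ∑ c ∈ nAC a ∩ nBC b, (nAD a ∩ nCD c).card) + (∑ a, ∑ c ∈ nAC a, ∑ e ∈ nAD a ∩ nCD c, (nCB c ∩ nDB e).card) + (∑ a, ∑ b ∈ nAB a, ∑ c ∈ nAC a ∩ nBC b, (nAD a ∩ nBD b).card) + (∑ a, ∑ b ∈ nAB a, ∑ e ∈ nAD a ∩ nBD b, (nBC b ∩ nDC e).card)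
      ≤ (∑ a, ∑ c ∈ nAC a, ∑ e ∈ nAD a, (nCB c ∩ nDB e).card) + (∑ a, ∑ b ∈ nAB a, ∑ e ∈ nAD a, (nBC b ∩ nDC e).card) + d * (∑ a, ∑ b ∈ nAB a, (nAC a ∩ nBC b).card) + d * (∑ b, ∑ c ∈ nBC b, (nBD b ∩ nCD c).card) + (∑ a, ∑ b ∈ nAB a, ∑ c ∈ nAC a ∩ nBC b, (nAD a ∩ nBD b ∩ nCD c).card)
        + d * (∑ a, ∑ b ∈ nAB a, (nAD a ∩ nBD b).card) + d * (∑ a, ∑ c ∈ nAC a, (nAD a ∩ nCD c).card) + t * d * (d * t) := by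
    have hsum := Finset.sum_le_sum (s := (univ : Finset α)) (fun a _ => Finset.sum_le_sum (fun e he => key₃ a e he))
    have cv1 : ∀ a : α, ∑ e ∈ nAD a, ∑ b ∈ nAB a, (nBC b ∩ (nAC a ∩ nDC e)).card = ∑ b ∈ nAB a, ∑ c ∈ nAC a ∩ nBC b, (nAD a ∩ nCD c).card := by
      intro a; rw [Finset.sum_comm]; refine Finset.sum_congr rfl (fun b _ => ?_)
      have : ∀ e, nBC b ∩ (nAC a ∩ nDC e) = nDC e ∩ (nAC a ∩ nBC b) := by intro e; ext c; simp only [Finset.mem_inter]; tauto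
      simp_rw [this]; rw [sum_card_inter_comm (nAD a) (nAC a ∩ nBC b) nDC nCD (fun e c => (cCD c e).symm)]; exact Finset.sum_congr rfl (fun c _ => by rw [Finset.inter_comm])
    have cv2 : ∀ a : α, ∑ e ∈ nAD a, ∑ c ∈ nAC a ∩ nDC e, (nCB c ∩ nDB e).card = ∑ c ∈ nAC a, ∑ e ∈ nAD a ∩ nCD c, (nCB c ∩ nDB e).card := fun a =>
      sum_inter_comm (nAD a) (nAC a) nDC nCD (fun e c => (cCD c e).symm) _
    have cv3 : ∀ a : α, ∑ e ∈ nAD a, ∑ b ∈ nAB a ∩ nDB e, (nBC b ∩ nAC a).card = ∑ b ∈ nAB a, ∑ c ∈ nAC a ∩ nBC b, (nAD a ∩ nBD b).card := by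
      intro a; rw [sum_inter_comm (nAD a) (nAB a) nDB nBD (fun e b => (cBD b e).symm)]; refine Finset.sum_congr rfl (fun b _ => ?_)
      rw [Finset.sum_const, Finset.sum_const, smul_eq_mul, smul_eq_mul, Finset.inter_comm (nBC b)]; ring
    have cv4 : ∀ a : α, ∑ e ∈ nAD a, ∑ b ∈ nAB a ∩ nDB e, (nBC b ∩ nDC e).card = ∑ b ∈ nAB a, ∑ e ∈ nAD a ∩ nBD b, (nBC b ∩ nDC e).card := fun a =>
      sum_inter_comm (nAD a) (nAB a) nDB nBD (fun e b => (cBD b e).symm) _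
    have cv5 : ∀ a : α, ∑ e ∈ nAD a, ∑ c ∈ nAC a, (nCB c ∩ nDB e).card = ∑ c ∈ nAC a, ∑ e ∈ nAD a, (nCB c ∩ nDB e).card := fun a => Finset.sum_comm
    have cv6 : ∀ a : α, ∑ e ∈ nAD a, ∑ b ∈ nAB a, (nBC b ∩ nDC e).card = ∑ b ∈ nAB a, ∑ e ∈ nAD a, (nBC b ∩ nDC e).card := fun a => Finset.sum_comm
    have cv7 : ∀ a : α, ∑ e ∈ nAD a, ∑ b ∈ nAB a ∩ nDB e, (nBC b ∩ (nAC a ∩ nDC e)).card = ∑ b ∈ nAB a, ∑ c ∈ nAC a ∩ nBC b, (nAD a ∩ nBD b ∩ nCD c).card := by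
      intro a; rw [sum_inter_comm (nAD a) (nAB a) nDB nBD (fun e b => (cBD b e).symm)]; refine Finset.sum_congr rfl (fun b _ => ?_)
      have : ∀ e, nBC b ∩ (nAC a ∩ nDC e) = nDC e ∩ (nAC a ∩ nBC b) := by intro e; ext c; simp only [Finset.mem_inter]; tauto
      simp_rw [this]; rw [sum_card_inter_comm (nAD a ∩ nBD b) (nAC a ∩ nBC b) nDC nCD (fun e c => (cCD c e).symm)]; exact Finset.sum_congr rfl (fun c _ => by rw [Finset.inter_comm])
    have cv8 : ∀ a : α, ∑ e ∈ nAD a, (nAB a ∩ nDB e).card = ∑ b ∈ nAB a, (nAD a ∩ nBD b).card := by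
      intro a
      have h' : ∑ e ∈ nAD a, (nAB a ∩ nDB e).card = ∑ e ∈ nAD a, (nDB e ∩ nAB a).card := Finset.sum_congr rfl (fun e _ => by rw [Finset.inter_comm])
      rw [h', sum_card_inter_comm (nAD a) (nAB a) nDB nBD (fun e b => (cBD b e).symm)]; exact Finset.sum_congr rfl (fun b _ => by rw [Finset.inter_comm])
    have cv9 : ∀ a : α, ∑ e ∈ nAD a, (nAC a ∩ nDC e).card = ∑ c ∈ nAC a, (nAD a ∩ nCD c).card := by
      intro a
      have h' : ∑ e ∈ nAD a, (nAC a ∩ nDC e).card = ∑ e ∈ nAD a, (nDC e ∩ nAC a).card := Finset.sum_congr rfl (fun e _ => by rw [Finset.inter_comm])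
      rw [h', sum_card_inter_comm (nAD a) (nAC a) nDC nCD (fun e c => (cCD c e).symm)]; exact Finset.sum_congr rfl (fun c _ => by rw [Finset.inter_comm])
    have cv8m : ∀ a : α, ∑ e ∈ nAD a, d * (nAB a ∩ nDB e).card = ∑ b ∈ nAB a, d * (nAD a ∩ nBD b).card := fun a => by
      rw [← Finset.mul_sum, ← Finset.mul_sum, cv8 a]
    have cv9m : ∀ a : α, ∑ e ∈ nAD a, d * (nAC a ∩ nDC e).card = ∑ c ∈ nAC a, d * (nAD a ∩ nCD c).card := fun a => by
      rw [← Finset.mul_sum, ← Finset.mul_sum, cv9 a]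
    have lhs : ∑ a ∈ (univ : Finset α), ∑ e ∈ nAD a,
        (4 * d ^ 2 + (∑ b ∈ nAB a, (nBC b ∩ (nAC a ∩ nDC e)).card) + (∑ c ∈ nAC a ∩ nDC e, (nCB c ∩ nDB e).card) + (∑ b ∈ nAB a ∩ nDB e, (nBC b ∩ nAC a).card) + (∑ b ∈ nAB a ∩ nDB e, (nBC b ∩ nDC e).card)) = t * d * (4 * d ^ 2) + (∑ a, ∑ b ∈ nAB a, ∑ c ∈ nAC a ∩ nBC b, (nAD a ∩ nCD c).card)
          + (∑ a, ∑ c ∈ nAC a, ∑ e ∈ nAD a ∩ nCD c, (nCB c ∩ nDB e).card) + (∑ a, ∑ b ∈ nAB a, ∑ c ∈ nAC a ∩ nBC b, (nAD a ∩ nBD b).card) + (∑ a, ∑ b ∈ nAB a, ∑ e ∈ nAD a ∩ nBD b, (nBC b ∩ nDC e).card) := by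
      simp only [Finset.sum_add_distrib, Finset.sum_const, smul_eq_mul, rAD, Finset.card_univ, hα,
        cv1, cv2, cv3, cv4]
      ring
    have diag₁ : ∑ a ∈ (univ : Finset α), ∑ e ∈ nAD a, ∑ b ∈ nAB a, (nAC a ∩ nBC b).card = d * ∑ a, ∑ b ∈ nAB a, (nAC a ∩ nBC b).card := by
      rw [Finset.mul_sum]; exact Finset.sum_congr rfl (fun a _ => by rw [Finset.sum_const, smul_eq_mul, rAD])
    have diag₂ : ∑ a ∈ (univ : Finset α), ∑ e ∈ nAD a, ∑ b ∈ nDB e, (nBC b ∩ nDC e).card = d * ∑ b, ∑ c ∈ nBC b, (nBD b ∩ nCD c).card := by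
      have step1 : ∑ a ∈ (univ : Finset α), ∑ e ∈ nAD a, ∑ b ∈ nDB e, (nBC b ∩ nDC e).card = d * ∑ e, ∑ b ∈ nDB e, (nBC b ∩ nDC e).card := by
        rw [edge_sum_comm nAD nDA cAD, Finset.mul_sum]; exact Finset.sum_congr rfl (fun e _ => by rw [Finset.sum_const, smul_eq_mul, rDA])
      have step2 : ∑ e, ∑ b ∈ nDB e, (nBC b ∩ nDC e).card = ∑ b, ∑ e ∈ nBD b, (nBC b ∩ nDC e).card := (edge_sum_comm nBD nDB cBD (fun b e => (nBC b ∩ nDC e).card)).symm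
      have step3 : ∀ b : β, ∑ e ∈ nBD b, (nBC b ∩ nDC e).card = ∑ c ∈ nBC b, (nBD b ∩ nCD c).card := by
        intro b
        have h' : ∑ e ∈ nBD b, (nBC b ∩ nDC e).card = ∑ e ∈ nBD b, (nDC e ∩ nBC b).card := Finset.sum_congr rfl (fun e _ => by rw [Finset.inter_comm])
        rw [h', sum_card_inter_comm (nBD b) (nBC b) nDC nCD (fun e c => (cCD c e).symm)]; exact Finset.sum_congr rfl (fun c _ => by rw [Finset.inter_comm])
      rw [step1, step2]
      congr 1
      exact Finset.sum_congr rfl (fun b _ => step3 b)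
    have rhs : ∑ a ∈ (univ : Finset α), ∑ e ∈ nAD a,
        ((∑ c ∈ nAC a, (nCB c ∩ nDB e).card) + (∑ b ∈ nAB a, (nBC b ∩ nDC e).card) + (∑ b ∈ nAB a, (nAC a ∩ nBC b).card) + (∑ b ∈ nDB e, (nBC b ∩ nDC e).card) + (∑ b ∈ nAB a ∩ nDB e, (nBC b ∩ (nAC a ∩ nDC e)).card) + d * (nAB a ∩ nDB e).card + d * (nAC a ∩ nDC e).card + d * t)
        = (∑ a, ∑ c ∈ nAC a, ∑ e ∈ nAD a, (nCB c ∩ nDB e).card) + (∑ a, ∑ b ∈ nAB a, ∑ e ∈ nAD a, (nBC b ∩ nDC e).card) + d * (∑ a, ∑ b ∈ nAB a, (nAC a ∩ nBC b).card) + d * (∑ b, ∑ c ∈ nBC b, (nBD b ∩ nCD c).card) + (∑ a, ∑ b ∈ nAB a, ∑ c ∈ nAC a ∩ nBC b, (nAD a ∩ nBD b ∩ nCD c).card)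
          + d * (∑ a, ∑ b ∈ nAB a, (nAD a ∩ nBD b).card) + d * (∑ a, ∑ c ∈ nAC a, (nAD a ∩ nCD c).card) + t * d * (d * t) := by
      rw [← diag₁, ← diag₂]
      simp only [Finset.sum_add_distrib, Finset.sum_const, smul_eq_mul, rAD, Finset.card_univ, hα,
        Finset.mul_sum, cv5, cv6, cv7, cv8m, cv9m]
      ring
    rw [lhs, rhs] at hsum; exact hsum
  nlinarith [m₁, m₂, m₃]

omit [Fintype β] [Fintype γ] [Fintype δ] [DecidableEq α] [DecidableEq β] in
/-- Every transversal `K₄` contains an `ABC`-triangle and a common `D`-neighbour of its three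
vertices, of which there are at most `d`: `N(K₄) ≤ d · T_ABC`. -/
theorem K4_le (d : ℕ) (nAB : α → Finset β) (nAC : α → Finset γ) (nAD : α → Finset δ) (nBC : β → Finset γ) (nBD : β → Finset δ) (nCD : γ → Finset δ) (rCD : ∀ c, (nCD c).card = d) :
    (∑ a, ∑ b ∈ nAB a, ∑ c ∈ nAC a ∩ nBC b, (nAD a ∩ nBD b ∩ nCD c).card) ≤ d * (∑ a, ∑ b ∈ nAB a, (nAC a ∩ nBC b).card) := by
  classical
  calc (∑ a, ∑ b ∈ nAB a, ∑ c ∈ nAC a ∩ nBC b, (nAD a ∩ nBD b ∩ nCD c).card) ≤ ∑ a, ∑ b ∈ nAB a, ∑ c ∈ nAC a ∩ nBC b, d :=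
        Finset.sum_le_sum (fun a _ => Finset.sum_le_sum (fun b _ => Finset.sum_le_sum (fun c _ => (Finset.card_le_card Finset.inter_subset_right).trans_eq (rCD c))))
    _ = d * (∑ a, ∑ b ∈ nAB a, (nAC a ∩ nBC b).card) := by
        rw [Finset.mul_sum]; refine Finset.sum_congr rfl (fun a _ => ?_)
        rw [Finset.mul_sum]; refine Finset.sum_congr rfl (fun b _ => ?_)
        rw [Finset.sum_const, smul_eq_mul, mul_comm]

/-- **COROLLARY L′** (FLATTF-w5n62g17 §8): no flat K-secant four-coordinate design has `8t > 17d`.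
Hypotheses on top of `flat_box_inequality`: `0 < d`; the four transversal triangle counts are equal to
`T₀` (the `|S| = 3` class equation for flat margins); and the `|S| = 4` class equation of
N7-FEASIBILITY §3.8 (a) in the integer form obtained by multiplying
`ΣN(C₄) = 16td³ − 2t²d² − t d s² − 3 d T_tot + ΣF₅ − N(K₄)` (flat: `2ΣB = 12td³`, `ΣC = 4td³`,
`ΣPaw = 3 d T_tot`, `T_tot = 4 T₀`, `s = T₀/(td) − 3d`) through by `t d`. Conclusion `8 t ≤ 17 d`. -/
theorem flat_ksecant_levels_le (d t T₀ : ℕ) (hd : 0 < d)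
    (hα : Fintype.card α = t) (hγ : Fintype.card γ = t) (hδ : Fintype.card δ = t) (nAB : α → Finset β) (nBA : β → Finset α) (nAC : α → Finset γ) (nCA : γ → Finset α) (nAD : α → Finset δ) (nDA : δ → Finset α) (nBC : β → Finset γ) (nCB : γ → Finset β)
    (nBD : β → Finset δ) (nDB : δ → Finset β) (nCD : γ → Finset δ) (nDC : δ → Finset γ) (cAB : ∀ a b, b ∈ nAB a ↔ a ∈ nBA b) (cAC : ∀ a c, c ∈ nAC a ↔ a ∈ nCA c)
    (cAD : ∀ a e, e ∈ nAD a ↔ a ∈ nDA e) (cBC : ∀ b c, c ∈ nBC b ↔ b ∈ nCB c)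
    (cBD : ∀ b e, e ∈ nBD b ↔ b ∈ nDB e) (cCD : ∀ c e, e ∈ nCD c ↔ c ∈ nDC e) (rAB : ∀ a, (nAB a).card = d) (rBA : ∀ b, (nBA b).card = d) (rAC : ∀ a, (nAC a).card = d) (rCA : ∀ c, (nCA c).card = d) (rAD : ∀ a, (nAD a).card = d) (rDA : ∀ e, (nDA e).card = d)
    (rBC : ∀ b, (nBC b).card = d) (rCB : ∀ c, (nCB c).card = d) (rBD : ∀ b, (nBD b).card = d) (rDB : ∀ e, (nDB e).card = d) (rCD : ∀ c, (nCD c).card = d) (rDC : ∀ e, (nDC e).card = d)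
    (hT₁ : (∑ a, ∑ b ∈ nAB a, (nAC a ∩ nBC b).card) = T₀) (hT₂ : (∑ a, ∑ b ∈ nAB a, (nAD a ∩ nBD b).card) = T₀) (hT₃ : (∑ a, ∑ c ∈ nAC a, (nAD a ∩ nCD c).card) = T₀)
    (hT₄ : (∑ b, ∑ c ∈ nBC b, (nBD b ∩ nCD c).card) = T₀)
    (hclass : (t : ℤ) * d * (((∑ a, ∑ b ∈ nAB a, ∑ e ∈ nAD a, (nBC b ∩ nDC e).card) + (∑ a, ∑ b ∈ nAB a, ∑ c ∈ nAC a, (nBD b ∩ nCD c).card) + (∑ a, ∑ c ∈ nAC a, ∑ e ∈ nAD a, (nCB c ∩ nDB e).card) : ℕ) : ℤ) = (t : ℤ) * d * (16 * t * d ^ 3 - 2 * t ^ 2 * d ^ 2 - 12 * d * T₀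
            + (((∑ a, ∑ c ∈ nAC a, ∑ e ∈ nAD a ∩ nCD c, (nCB c ∩ nDB e).card) + (∑ a, ∑ b ∈ nAB a, ∑ e ∈ nAD a ∩ nBD b, (nBC b ∩ nDC e).card) + (∑ a, ∑ b ∈ nAB a, ∑ c ∈ nAC a ∩ nBC b, (nBD b ∩ nCD c).card) + (∑ a, ∑ b ∈ nAB a, ∑ c ∈ nAC a, (nAD a ∩ nBD b ∩ nCD c).card)
                + (∑ a, ∑ b ∈ nAB a, ∑ c ∈ nAC a ∩ nBC b, (nAD a ∩ nCD c).card) + (∑ a, ∑ b ∈ nAB a, ∑ _c ∈ nAC a ∩ nBC b, (nAD a ∩ nBD b).card) : ℕ) : ℤ) - ((∑ a, ∑ b ∈ nAB a, ∑ c ∈ nAC a ∩ nBC b, (nAD a ∩ nBD b ∩ nCD c).card : ℕ) : ℤ)) - (3 * t * d ^ 2 - T₀ : ℤ) ^ 2) :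
    8 * t ≤ 17 * d := by
  classical
  have hL := flat_box_inequality d t hα hγ hδ nAB nBA nAC nCA nAD nDA nBC nCB nBD nDB nCD nDC cAB cAC cAD cBC cBD cCD rAB rBA rAC rCA rAD rDA rBC rCB rBD rDB rCD rDC
  have hK := K4_le (α := α) d nAB nAC nAD nBC nBD nCD rCD
  rw [hT₁, hT₂, hT₃, hT₄] at hL; rw [hT₁] at hK
  generalize hN : ((∑ a, ∑ b ∈ nAB a, ∑ e ∈ nAD a, (nBC b ∩ nDC e).card) + (∑ a, ∑ b ∈ nAB a, ∑ c ∈ nAC a, (nBD b ∩ nCD c).card) + (∑ a, ∑ c ∈ nAC a, ∑ e ∈ nAD a, (nCB c ∩ nDB e).card)) = SN at hL hclass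
  generalize hF : ((∑ a, ∑ c ∈ nAC a, ∑ e ∈ nAD a ∩ nCD c, (nCB c ∩ nDB e).card) + (∑ a, ∑ b ∈ nAB a, ∑ e ∈ nAD a ∩ nBD b, (nBC b ∩ nDC e).card) + (∑ a, ∑ b ∈ nAB a, ∑ c ∈ nAC a ∩ nBC b, (nBD b ∩ nCD c).card) + (∑ a, ∑ b ∈ nAB a, ∑ c ∈ nAC a, (nAD a ∩ nBD b ∩ nCD c).card)
                + (∑ a, ∑ b ∈ nAB a, ∑ c ∈ nAC a ∩ nBC b, (nAD a ∩ nCD c).card) + (∑ a, ∑ b ∈ nAB a, ∑ _c ∈ nAC a ∩ nBC b, (nAD a ∩ nBD b).card)) = SF at hL hclass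
  generalize hKK : (∑ a, ∑ b ∈ nAB a, ∑ c ∈ nAC a ∩ nBC b, (nAD a ∩ nBD b ∩ nCD c).card) = K
    at hL hclass hK
  rcases Nat.eq_zero_or_pos t with rfl | ht
  · simp
  have hLz : (12 * t * d ^ 3 + 2 * SF : ℤ) ≤ 2 * SN + 3 * t ^ 2 * d ^ 2 + 3 * d * (T₀ + T₀ + T₀ + T₀) + 3 * K := by exact_mod_cast hL
  have hKz : (K : ℤ) ≤ d * T₀ := by exact_mod_cast hK
  have htd : (0 : ℤ) < t * d := by positivity
  have h1 : (t : ℤ) * d * (12 * t * d ^ 3 + 2 * SF) ≤ (t : ℤ) * d * (2 * SN + 3 * t ^ 2 * d ^ 2 + 3 * d * (T₀ + T₀ + T₀ + T₀) + 3 * K) := mul_le_mul_of_nonneg_left hLz htd.le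
  have h2 : 2 * (T₀ : ℤ) ^ 2 + t ^ 3 * d ^ 3 ≤ 2 * t ^ 2 * d ^ 4 + t * d * K := by linarith [h1, hclass]
  have h3 : (t : ℤ) * d * K ≤ t * d * (d * T₀) := mul_le_mul_of_nonneg_left hKz htd.le
  have h4 : 2 * (T₀ : ℤ) ^ 2 + t ^ 3 * d ^ 3 ≤ 2 * t ^ 2 * d ^ 4 + t * d ^ 2 * T₀ := by linarith [h2, h3]
  have key : (t : ℤ) ^ 2 * d ^ 3 * (17 * d - 8 * t) = (4 * T₀ - t * d ^ 2) ^ 2 + 8 * (2 * t ^ 2 * d ^ 4 + t * d ^ 2 * T₀ - 2 * T₀ ^ 2 - t ^ 3 * d ^ 3) := by ring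
  have h5 : (0 : ℤ) ≤ t ^ 2 * d ^ 3 * (17 * d - 8 * t) := by
    rw [key]
    have hsq := sq_nonneg (4 * (T₀ : ℤ) - t * d ^ 2)
    linarith
  have hpos : (0 : ℤ) < t ^ 2 * d ^ 3 := by positivity
  by_contra hc
  have hc' : (17 * d : ℤ) < 8 * t := by exact_mod_cast Nat.lt_of_not_le hc
  have h6 : (0 : ℤ) < t ^ 2 * d ^ 3 * (8 * t - 17 * d) := mul_pos hpos (by linarith)
  have h7 : (t : ℤ) ^ 2 * d ^ 3 * (17 * d - 8 * t) + t ^ 2 * d ^ 3 * (8 * t - 17 * d) = 0 := by ring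
  linarith

end Design

end FlatFourCoordinateBoxes

end Summit.Ventures.HSemireg
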